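import Summits.AnomalousDissipation.AnomalousDissipation.Theorems.TaylorCertificatesKolmogorovFloorAssemblyResidual
import Literature.Analysis.FunctionSpaces.TorusTrigPoly
import Literature.Analysis.FunctionSpaces.TorusWeightedGalerkinCoefficients

/-!
# ASSEMBLY of line `Sketch`, part 4: arithmetic of a forced mode line in the digit frame
(crux stmt-AnomalousDissipation-15122; line lead)

From the FRAME facts: the integer hypotheses of DET / LINE-ALGEBRA / LINE-BOUNDS for every forced mode (signs and non-vanishing
of `E_m, N_m, D`, sites vs balls), the size domination by `Λ = 9B¹⁴`, the sheet-determinant facts, force transversality and the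
Parseval identity in the triad.
-/

noncomputable section

set_option linter.dupNamespace false

open Matrix Finset UnitAddTorus MeasureTheory
open scoped BigOperators ComplexConjugate InnerProductSpace ENNReal

namespace Summit.AnomalousDissipation.AnomalousDissipation.Theorems.KolmogorovFloor.Response

open Literature.Analysis.FunctionSpaces Literature.Analysis.FluidPDE

/-! ## Part 4a: arithmetic of a forced mode line in the digit frame

From the FRAME facts at level `L` (orthogonality, sizes, and per mode: non-resonance, admissibility, angle
condition) we discharge, for every forced mode `k`, the hypotheses of the DET, LINE-ALGEBRA and LINE-BOUNDS
statements: signs and non-vanishing of `E_m, N_m, D`, the force transversality and the Parseval identity in the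
triad, the position of the line sites relative to the balls, and the domination of the seven integers and `1/|G|`
by the single size `Λ = 9 B¹⁴`. -/

section FrameArith

/-- Cauchy–Schwarz on `ℤ³` through Lagrange's identity: `(k·w)² ≤ (k·k)(w·w)`. -/
theorem dotProduct_sq_le (k w : Fin 3 → ℤ) : (k ⬝ᵥ w) ^ 2 ≤ (k ⬝ᵥ k) * (w ⬝ᵥ w) := by
  have h := cross3_dotProduct_self k w
  have h0 : 0 ≤ cross3 k w ⬝ᵥ cross3 k w := by
    rw [dotProduct_fin3]; nlinarith [sq_nonneg (cross3 k w 0), sq_nonneg (cross3 k w 1), sq_nonneg (cross3 k w 2)]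
  linarith

/-- `0 ≤ w·w` on `ℤ³`. -/
theorem dotProduct_self_nonneg' (w : Fin 3 → ℤ) : 0 ≤ w ⬝ᵥ w := by
  rw [dotProduct_fin3]; nlinarith [sq_nonneg (w 0), sq_nonneg (w 1), sq_nonneg (w 2)]

/-- A nonzero lattice vector has `1 ≤ k·k`. -/
theorem one_le_dotProduct_self {k : Fin 3 → ℤ} (hk : k ≠ 0) : 1 ≤ k ⬝ᵥ k := by
  rw [dotProduct_fin3]
  have hex : k 0 ≠ 0 ∨ k 1 ≠ 0 ∨ k 2 ≠ 0 := by
    by_contra h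
    push Not at h
    apply hk; ext i; fin_cases i
    · exact h.1
    · exact h.2.1
    · exact h.2.2
  rcases hex with h | h | h
  · have := Int.one_le_abs h; nlinarith [sq_abs (k 0), sq_nonneg (k 1), sq_nonneg (k 2)]
  · have := Int.one_le_abs h; nlinarith [sq_abs (k 1), sq_nonneg (k 0), sq_nonneg (k 2)]
  · have := Int.one_le_abs h; nlinarith [sq_abs (k 2), sq_nonneg (k 0), sq_nonneg (k 1)]

/-- The small-divisor estimate of a tall frame: `s² ≤ K·X2` and `16K ≤ X2` give `4|s| ≤ X2`. -/
theorem four_abs_s_le {K s X2 : ℤ} (hK : 0 ≤ K) (h1 : s ^ 2 ≤ K * X2) (h2 : 16 * K ≤ X2) : 4 * |s| ≤ X2 := by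
  have hX : 0 ≤ X2 := by linarith
  have hsq : (4 * |s|) ^ 2 ≤ X2 ^ 2 := by nlinarith [sq_abs s]
  exact (abs_le_of_sq_le_sq' hsq hX).2

/-- `|m| X2 ≤ m² X2` for `m ≠ 0`, `X2 ≥ 0` (and its scaled forms). -/
theorem abs_mul_le_sq_mul {m X2 : ℤ} (hm : m ≠ 0) (hX : 0 ≤ X2) (c : ℤ) (hcm : c ≤ |m|) :
    c * (|m| * X2) ≤ m ^ 2 * X2 := by
  have h1 : c * |m| ≤ |m| * |m| := mul_le_mul_of_nonneg_right hcm (abs_nonneg m)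
  have h2 : |m| * |m| = m ^ 2 := by rw [abs_mul_abs_self, sq]
  have hm1 := Int.one_le_abs hm
  nlinarith

/-- **Lower bounds for `N_m = K + 2ms + m²X2`** in a tall frame: `1 ≤ N_m` for all `m`, `m² X2 ≤ 4 N_m` for
`|m| ≥ 2`, and `2 X2 ≤ 4 N_m` for `m ≠ 0`. -/
theorem N_bounds {K s X2 : ℤ} (hK : 1 ≤ K) (h1 : s ^ 2 ≤ K * X2) (h2 : 16 * K ≤ X2) (m : ℤ) :
    1 ≤ K + 2 * m * s + m ^ 2 * X2 ∧ (2 ≤ |m| → m ^ 2 * X2 ≤ 4 * (K + 2 * m * s + m ^ 2 * X2)) ∧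
      (m ≠ 0 → 2 * X2 ≤ 4 * (K + 2 * m * s + m ^ 2 * X2)) := by
  have hs := four_abs_s_le (by linarith) h1 h2
  have hX : 0 ≤ X2 := by linarith
  -- `4·(2ms) ≥ −2|m| X2`
  have hms : -(2 * (|m| * X2)) ≤ 4 * (2 * m * s) := by
    have h3 : |2 * m * s| = 2 * |m| * |s| := by rw [abs_mul, abs_mul]; simp
    have h4 : -(|2 * m * s|) ≤ 2 * m * s := neg_abs_le _
    nlinarith [abs_nonneg m, abs_nonneg s]
  by_cases hm0 : m = 0
  · subst hm0
    refine ⟨by simp; linarith, fun h => by simp at h, fun h => absurd rfl h⟩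
  have hA := abs_mul_le_sq_mul hm0 hX 1 (Int.one_le_abs hm0)
  have hB := abs_mul_le_sq_mul hm0 hX 2
  have hsq : X2 ≤ m ^ 2 * X2 := by
    have : 1 ≤ m ^ 2 := by nlinarith [Int.one_le_abs hm0, sq_abs m]
    nlinarith
  refine ⟨by nlinarith, fun hm => ?_, fun _ => by nlinarith⟩
  have hB' := hB hm
  nlinarith

/-- Lower bound for `E_m = N_m − X2` beyond `|m| ≥ 3`: `m² X2 ≤ 4 E_m`. -/
theorem E_bound {K s X2 : ℤ} (hK : 1 ≤ K) (h1 : s ^ 2 ≤ K * X2) (h2 : 16 * K ≤ X2) {m : ℤ} (hm : 3 ≤ |m|) :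
    m ^ 2 * X2 ≤ 4 * (K + 2 * m * s + (m ^ 2 - 1) * X2) := by
  have hs := four_abs_s_le (by linarith) h1 h2
  have hX : 0 ≤ X2 := by linarith
  have hms : -(2 * (|m| * X2)) ≤ 4 * (2 * m * s) := by
    have h3 : |2 * m * s| = 2 * |m| * |s| := by rw [abs_mul, abs_mul]; simp
    have h4 : -(|2 * m * s|) ≤ 2 * m * s := neg_abs_le _
    nlinarith [abs_nonneg m, abs_nonneg s]
  have hm0 : m ≠ 0 := by intro h; rw [h] at hm; simp at hm
  have hC := abs_mul_le_sq_mul hm0 hX 3 hm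
  have h9 : 9 * X2 ≤ m ^ 2 * X2 := by
    have : 9 ≤ m ^ 2 := by nlinarith [sq_abs m]
    nlinarith
  nlinarith

/-- Non-resonance of the two near sites: `K < 2|s|` forbids `E_{±1} = K ± 2s = 0`. -/
theorem E_one_ne_zero {K s : ℤ} (hK : 0 < K) (hres : K < 2 * |s|) : K + 2 * s ≠ 0 ∧ K - 2 * s ≠ 0 := by
  constructor <;> intro h <;> rcases abs_cases s with ⟨hs, -⟩ | ⟨hs, -⟩ <;> omega

/-- Upper bound for `N_m` at any site `m ≠ 0`: `N_m ≤ K + 2 m² X2`. -/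
theorem N_upper {K s X2 : ℤ} (hK : 0 ≤ K) (h1 : s ^ 2 ≤ K * X2) (h2 : 16 * K ≤ X2) {m : ℤ} (hm : m ≠ 0) :
    K + 2 * m * s + m ^ 2 * X2 ≤ K + 2 * (m ^ 2 * X2) := by
  have hs := four_abs_s_le hK h1 h2
  have hX : 0 ≤ X2 := by linarith
  have h3 : 2 * m * s ≤ 2 * (|m| * |s|) := by
    have : 2 * m * s ≤ |2 * m * s| := le_abs_self _
    rw [abs_mul, abs_mul] at this; simp at this; linarith
  have h6 : 4 * (|m| * |s|) ≤ |m| * X2 := by nlinarith [abs_nonneg m]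
  have h7 := abs_mul_le_sq_mul hm hX 1 (Int.one_le_abs hm)
  nlinarith [abs_nonneg m, abs_nonneg s]

end FrameArith

/-! ## Part 4b: the hypotheses of DET / LINE-ALGEBRA / LINE-BOUNDS for a forced mode of the digit frame -/

section LineFacts

/-- **Integer facts of a forced mode line** in a frame with `ξ ⊥ e`, `B⁶ ≤ ξ·ξ ≤ 3B⁶`, `B⁴ ≤ e·e ≤ 3B⁴`,
`n·n = (ξ·ξ)(e·e)` (`B = 2L+1`), for a mode `0 < k·k ≤ L²` that is non-resonant and admissible. -/
theorem lineFacts_int {L : ℕ} (hL : 1 ≤ L) {ξ e k : Fin 3 → ℤ}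
    (hX2lo : (2 * (L : ℤ) + 1) ^ 6 ≤ ξ ⬝ᵥ ξ) (he2lo : (2 * (L : ℤ) + 1) ^ 4 ≤ e ⬝ᵥ e)
    (hn2 : cross3 ξ e ⬝ᵥ cross3 ξ e = (ξ ⬝ᵥ ξ) * (e ⬝ᵥ e))
    (hk0 : k ≠ 0) (hkL : k ⬝ᵥ k ≤ (L : ℤ) ^ 2) (hres : k ⬝ᵥ k < 2 * |k ⬝ᵥ ξ|) (ha : k ⬝ᵥ e ≠ 0)
    (hc : k ⬝ᵥ cross3 ξ e ≠ 0) :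
    let d := lineData k ξ e
    (1 ≤ d.K ∧ d.s ^ 2 ≤ d.K * d.X2 ∧ 16 * d.K ≤ d.X2 ∧ 1 ≤ d.X2 ∧ 1 ≤ d.e2 ∧ 1 ≤ d.n2 ∧ 1 ≤ |d.a| ∧ 1 ≤ |d.c| ∧
      0 < d.D ∧ 4 * (L : ℤ) ^ 2 < d.X2) ∧
    (∀ m : ℤ, m % 2 = 1 → d.E m ≠ 0) ∧ (∀ m : ℤ, 1 ≤ d.N m) ∧ (∀ m : ℤ, 3 ≤ |m| → m ^ 2 * d.X2 ≤ 4 * d.E m) ∧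
    (∀ m : ℤ, 2 ≤ |m| → m ^ 2 * d.X2 ≤ 4 * d.N m) ∧ (∀ m : ℤ, m ≠ 0 → 2 * d.X2 ≤ 4 * d.N m) ∧
    (∀ m : ℤ, m ≠ 0 → d.N m ≤ d.K + 2 * (m ^ 2 * d.X2)) := by
  intro d
  have hB3 : (3 : ℤ) ≤ 2 * (L : ℤ) + 1 := by omega
  have hB6 : (3 : ℤ) ^ 6 ≤ (2 * (L : ℤ) + 1) ^ 6 := pow_le_pow_left₀ (by norm_num) hB3 6
  have hB4 : (3 : ℤ) ^ 4 ≤ (2 * (L : ℤ) + 1) ^ 4 := pow_le_pow_left₀ (by norm_num) hB3 4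
  have hK1 : 1 ≤ d.K := one_le_dotProduct_self hk0
  have hKL : d.K ≤ (L : ℤ) ^ 2 := hkL
  have hX2 : (2 * (L : ℤ) + 1) ^ 6 ≤ d.X2 := hX2lo
  have he2 : (2 * (L : ℤ) + 1) ^ 4 ≤ d.e2 := he2lo
  have hs : d.s ^ 2 ≤ d.K * d.X2 := dotProduct_sq_le k ξ
  -- `16 L² ≤ B⁶`: `B² ≥ 4L²` and `B⁴ ≥ 81 ≥ 4`
  have hLB : 4 * (L : ℤ) ^ 2 ≤ (2 * (L : ℤ) + 1) ^ 2 := by nlinarith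
  have h16 : 16 * d.K ≤ d.X2 := by
    have : 16 * (L : ℤ) ^ 2 ≤ (2 * (L : ℤ) + 1) ^ 6 := by
      have h1 : (2 * (L : ℤ) + 1) ^ 6 = (2 * (L : ℤ) + 1) ^ 2 * (2 * (L : ℤ) + 1) ^ 4 := by ring
      rw [h1]; nlinarith
    linarith
  have h4L : 4 * (L : ℤ) ^ 2 < d.X2 := by
    have : 4 * (L : ℤ) ^ 2 < (2 * (L : ℤ) + 1) ^ 6 := by
      have h1 : (2 * (L : ℤ) + 1) ^ 6 = (2 * (L : ℤ) + 1) ^ 2 * (2 * (L : ℤ) + 1) ^ 4 := by ring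
      rw [h1]; nlinarith
    linarith
  have hX1 : 1 ≤ d.X2 := by linarith
  have he1 : 1 ≤ d.e2 := by linarith
  have hn1 : 1 ≤ d.n2 := by
    show 1 ≤ cross3 ξ e ⬝ᵥ cross3 ξ e
    rw [hn2]; nlinarith
  have ha1 : 1 ≤ |d.a| := Int.one_le_abs ha
  have hc1 : 1 ≤ |d.c| := Int.one_le_abs hc
  have hD : 0 < d.D := by
    show 0 < d.c ^ 2 * d.e2 + d.a ^ 2 * d.n2
    have h1 : 1 ≤ d.c ^ 2 := by nlinarith [sq_abs d.c]
    have h2 : 1 ≤ d.a ^ 2 := by nlinarith [sq_abs d.a]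
    nlinarith
  refine ⟨⟨hK1, hs, h16, hX1, he1, hn1, ha1, hc1, hD, h4L⟩, ?_, ?_, ?_, ?_, ?_, ?_⟩
  · -- `E_m ≠ 0` for odd `m`
    intro m hm
    rcases le_or_gt 3 (|m|) with h3 | h3
    · have := E_bound hK1 hs h16 h3
      have h9 : 9 * d.X2 ≤ m ^ 2 * d.X2 := by
        have : 9 ≤ m ^ 2 := by nlinarith [sq_abs m]
        nlinarith
      show d.K + 2 * m * d.s + (m ^ 2 - 1) * d.X2 ≠ 0
      intro h0; nlinarith
    · -- `|m| ≤ 2` and odd: `m = ±1`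
      have hm1 : m = 1 ∨ m = -1 := by
        have := le_abs_self m; have := neg_abs_le m; omega
      have hE := E_one_ne_zero (K := d.K) (s := d.s) (lt_of_lt_of_le zero_lt_one hK1) hres
      rcases hm1 with rfl | rfl
      · show d.K + 2 * 1 * d.s + (1 ^ 2 - 1) * d.X2 ≠ 0
        intro h; apply hE.1; linarith
      · show d.K + 2 * (-1) * d.s + ((-1) ^ 2 - 1) * d.X2 ≠ 0
        intro h; apply hE.2; linarith
  · intro m; exact (N_bounds hK1 hs h16 m).1
  · intro m hm; exact E_bound hK1 hs h16 hm
  · intro m hm; exact (N_bounds hK1 hs h16 m).2.1 hm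
  · intro m hm; exact (N_bounds hK1 hs h16 m).2.2 hm
  · intro m hm; exact N_upper (by linarith) hs h16 hm

/-- Monotonicity of powers of the base `B ≥ 1` (integers). -/
theorem pow_mono_base {B : ℤ} (hB : 1 ≤ B) {n m : ℕ} (h : n ≤ m) : B ^ n ≤ B ^ m :=
  pow_le_pow_right₀ hB h

/-- **Size facts of a forced mode line** against the single size `Λ = 9 B¹⁴`: every one of
`|a|, |c|, |s|, K, X2, e2, n2` and `4 s² X2` is at most `Λ`. -/
theorem lineFacts_size {L : ℕ} (hL : 1 ≤ L) {ξ e k : Fin 3 → ℤ}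
    (hX2hi : ξ ⬝ᵥ ξ ≤ 3 * (2 * (L : ℤ) + 1) ^ 6) (he2hi : e ⬝ᵥ e ≤ 3 * (2 * (L : ℤ) + 1) ^ 4)
    (hn2 : cross3 ξ e ⬝ᵥ cross3 ξ e = (ξ ⬝ᵥ ξ) * (e ⬝ᵥ e)) (hkL : k ⬝ᵥ k ≤ (L : ℤ) ^ 2) :
    let d := lineData k ξ e
    let Λ : ℝ := 9 * (2 * (L : ℝ) + 1) ^ 14
    (|d.a| : ℝ) ≤ Λ ∧ (|d.c| : ℝ) ≤ Λ ∧ (|d.s| : ℝ) ≤ Λ ∧ (d.K : ℝ) ≤ Λ ∧ (d.X2 : ℝ) ≤ Λ ∧ (d.e2 : ℝ) ≤ Λ ∧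
      (d.n2 : ℝ) ≤ Λ ∧ 4 * (d.s : ℝ) ^ 2 * (d.X2 : ℝ) ≤ Λ := by
  intro d Λ
  -- everything in `ℤ` with `B := 2L+1`
  obtain ⟨B, hBdef⟩ : ∃ B : ℤ, B = 2 * (L : ℤ) + 1 := ⟨_, rfl⟩
  have hB3 : 3 ≤ B := by omega
  have hB1 : 1 ≤ B := by omega
  have hB0 : 0 ≤ B := by omega
  have hΛ : Λ = ((9 * B ^ 14 : ℤ) : ℝ) := by rw [hBdef]; push_cast; ring
  have hLB : (L : ℤ) ^ 2 ≤ B ^ 2 := by rw [hBdef]; nlinarith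
  have h4LB : 4 * (L : ℤ) ^ 2 ≤ B ^ 2 := by rw [hBdef]; nlinarith
  have hK0 : 0 ≤ d.K := dotProduct_self_nonneg' k
  have hK : d.K ≤ B ^ 2 := hkL.trans hLB
  have hX2' : d.X2 ≤ 3 * B ^ 6 := by rw [hBdef]; exact hX2hi
  have he2' : d.e2 ≤ 3 * B ^ 4 := by rw [hBdef]; exact he2hi
  have hX20 : 0 ≤ d.X2 := dotProduct_self_nonneg' ξ
  have he20 : 0 ≤ d.e2 := dotProduct_self_nonneg' e
  have hn2' : d.n2 = d.X2 * d.e2 := hn2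
  have hn2le : d.n2 ≤ 9 * B ^ 10 := by
    rw [hn2']
    calc d.X2 * d.e2 ≤ (3 * B ^ 6) * (3 * B ^ 4) := mul_le_mul hX2' he2' he20 (by positivity)
      _ = 9 * B ^ 10 := by ring
  have hP : ∀ {n m : ℕ}, n ≤ m → B ^ n ≤ B ^ m := fun h => pow_mono_base hB1 h
  -- squares
  have ha2 : d.a ^ 2 ≤ (9 * B ^ 14) ^ 2 := by
    calc d.a ^ 2 ≤ d.K * d.e2 := dotProduct_sq_le k e
      _ ≤ B ^ 2 * (3 * B ^ 4) := mul_le_mul hK he2' he20 (by positivity)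
      _ = 3 * B ^ 6 := by ring
      _ ≤ 81 * B ^ 28 := by nlinarith [hP (show 6 ≤ 28 by norm_num), pow_nonneg hB0 6]
      _ = (9 * B ^ 14) ^ 2 := by ring
  have hc2 : d.c ^ 2 ≤ (9 * B ^ 14) ^ 2 := by
    calc d.c ^ 2 ≤ d.K * d.n2 := dotProduct_sq_le k (cross3 ξ e)
      _ ≤ B ^ 2 * (9 * B ^ 10) := mul_le_mul hK hn2le (by rw [hn2']; positivity) (by positivity)
      _ = 9 * B ^ 12 := by ring
      _ ≤ 81 * B ^ 28 := by nlinarith [hP (show 12 ≤ 28 by norm_num), pow_nonneg hB0 12]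
      _ = (9 * B ^ 14) ^ 2 := by ring
  have hs2 : d.s ^ 2 ≤ 3 * (L : ℤ) ^ 2 * B ^ 6 := by
    calc d.s ^ 2 ≤ d.K * d.X2 := dotProduct_sq_le k ξ
      _ ≤ (L : ℤ) ^ 2 * (3 * B ^ 6) := mul_le_mul hkL hX2' hX20 (by positivity)
      _ = 3 * (L : ℤ) ^ 2 * B ^ 6 := by ring
  have hs2' : d.s ^ 2 ≤ (9 * B ^ 14) ^ 2 := by
    calc d.s ^ 2 ≤ 3 * (L : ℤ) ^ 2 * B ^ 6 := hs2
      _ ≤ 3 * B ^ 2 * B ^ 6 := by nlinarith [pow_nonneg hB0 6]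
      _ = 3 * B ^ 8 := by ring
      _ ≤ 81 * B ^ 28 := by nlinarith [hP (show 8 ≤ 28 by norm_num), pow_nonneg hB0 8]
      _ = (9 * B ^ 14) ^ 2 := by ring
  have h9pos : 0 ≤ 9 * B ^ 14 := by positivity
  have habs : ∀ {x : ℤ}, x ^ 2 ≤ (9 * B ^ 14) ^ 2 → (|x| : ℝ) ≤ Λ := by
    intro x hx
    have := (abs_le_of_sq_le_sq' hx h9pos)
    rw [hΛ]
    have h' : |x| ≤ 9 * B ^ 14 := abs_le.2 this
    exact_mod_cast h'
  have hcast : ∀ {x : ℤ}, x ≤ 9 * B ^ 14 → (x : ℝ) ≤ Λ := by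
    intro x hx; rw [hΛ]; exact_mod_cast hx
  refine ⟨habs ha2, habs hc2, habs hs2', hcast ?_, hcast ?_, hcast ?_, hcast ?_, ?_⟩
  · calc d.K ≤ B ^ 2 := hK
      _ ≤ B ^ 14 := hP (by norm_num)
      _ ≤ 9 * B ^ 14 := by nlinarith [pow_nonneg hB0 14]
  · calc d.X2 ≤ 3 * B ^ 6 := hX2'
      _ ≤ 9 * B ^ 14 := by nlinarith [hP (show 6 ≤ 14 by norm_num), pow_nonneg hB0 6]
  · calc d.e2 ≤ 3 * B ^ 4 := he2'
      _ ≤ 9 * B ^ 14 := by nlinarith [hP (show 4 ≤ 14 by norm_num), pow_nonneg hB0 4]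
  · calc d.n2 ≤ 9 * B ^ 10 := hn2le
      _ ≤ 9 * B ^ 14 := by nlinarith [hP (show 10 ≤ 14 by norm_num)]
  · -- `4 s² X2 ≤ 36 L² B¹² ≤ 9 B¹⁴`
    have h1 : 4 * d.s ^ 2 * d.X2 ≤ 9 * B ^ 14 := by
      calc 4 * d.s ^ 2 * d.X2 ≤ 4 * (3 * (L : ℤ) ^ 2 * B ^ 6) * (3 * B ^ 6) :=
            mul_le_mul (by linarith) hX2' hX20 (by positivity)
        _ = 9 * (4 * (L : ℤ) ^ 2) * B ^ 12 := by ring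
        _ ≤ 9 * B ^ 2 * B ^ 12 := by nlinarith [pow_nonneg hB0 12]
        _ = 9 * B ^ 14 := by ring
    rw [hΛ]; exact_mod_cast h1

/-- **The sheet determinant does not vanish and is not too small**: from the DET bound,
`G ≤ −(K X2 − s²)/(4 s² X2)` with `1 ≤ K X2 − s²` and `4 s² X2 ≤ Λ` give `G ≠ 0` and `Λ⁻¹ ≤ |G|`. -/
theorem G_facts {d : LineData} {J : ℕ} {Λ : ℝ} (hΛ : 0 < Λ)
    (hdet : d.G J ≤ -(((d.K * d.X2 - d.s ^ 2 : ℤ) : ℝ) / (4 * ((d.s : ℝ) ^ 2) * (d.X2 : ℝ))))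
    (hnum : 1 ≤ d.K * d.X2 - d.s ^ 2) (hs : d.s ≠ 0) (hX2 : 1 ≤ d.X2)
    (hsz : 4 * (d.s : ℝ) ^ 2 * (d.X2 : ℝ) ≤ Λ) : d.G J ≠ 0 ∧ Λ⁻¹ ≤ |d.G J| := by
  have hden : 0 < 4 * ((d.s : ℝ) ^ 2) * (d.X2 : ℝ) := by
    have h1 : (0 : ℝ) < (d.s : ℝ) ^ 2 := by
      have : (d.s : ℝ) ≠ 0 := by exact_mod_cast hs
      positivity
    have h2 : (0 : ℝ) < (d.X2 : ℝ) := by exact_mod_cast (show (0 : ℤ) < d.X2 by linarith)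
    positivity
  have hnum' : (1 : ℝ) ≤ ((d.K * d.X2 - d.s ^ 2 : ℤ) : ℝ) := by exact_mod_cast hnum
  have hr : Λ⁻¹ ≤ ((d.K * d.X2 - d.s ^ 2 : ℤ) : ℝ) / (4 * ((d.s : ℝ) ^ 2) * (d.X2 : ℝ)) := by
    rw [inv_eq_one_div, div_le_div_iff₀ hΛ hden]
    nlinarith
  have hG : d.G J < 0 := by
    have : 0 < ((d.K * d.X2 - d.s ^ 2 : ℤ) : ℝ) / (4 * ((d.s : ℝ) ^ 2) * (d.X2 : ℝ)) := by positivity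
    linarith
  refine ⟨hG.ne, ?_⟩
  rw [abs_of_neg hG]
  linarith

/-- **Force transversality in the triad**: `k · v = 0` gives `a ve + s vx + c vn = 0`. -/
theorem force_transversal {ξ e k : Fin 3 → ℤ} (hxe : ξ ⬝ᵥ e = 0) (he : e ⬝ᵥ e ≠ 0) (hX : ξ ⬝ᵥ ξ ≠ 0)
    (hn : cross3 ξ e ⬝ᵥ cross3 ξ e = (e ⬝ᵥ e) * (ξ ⬝ᵥ ξ)) (v : EuclideanSpace ℂ (Fin 3)) (hv : ipair k v = 0) :
    ((lineData k ξ e).a : ℂ) * (lineForce ξ e v).ve + ((lineData k ξ e).s : ℂ) * (lineForce ξ e v).vx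
      + ((lineData k ξ e).c : ℂ) * (lineForce ξ e v).vn = 0 := by
  have htr := force_triad hxe he hX hn v
  have h1 := congrArg (ipair k) htr
  rw [hv, ipair_add, ipair_add, ipair_smul, ipair_smul, ipair_smul, ipair_freqVec, ipair_freqVec, ipair_freqVec] at h1
  simp only [lineData_a, lineData_s, lineData_c]
  rw [h1]; ring

/-- **The Parseval identity in the triad**: `a²/e2 + s²/X2 + c²/n2 = K`. -/
theorem parseval_triad {ξ e : Fin 3 → ℤ} (hxe : ξ ⬝ᵥ e = 0) (he : e ⬝ᵥ e ≠ 0) (hX : ξ ⬝ᵥ ξ ≠ 0)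
    (hn : cross3 ξ e ⬝ᵥ cross3 ξ e = (e ⬝ᵥ e) * (ξ ⬝ᵥ ξ)) (k : Fin 3 → ℤ) :
    ((lineData k ξ e).a : ℂ) ^ 2 / ((lineData k ξ e).e2 : ℂ) + ((lineData k ξ e).s : ℂ) ^ 2 / ((lineData k ξ e).X2 : ℂ)
      + ((lineData k ξ e).c : ℂ) ^ 2 / ((lineData k ξ e).n2 : ℂ) = ((lineData k ξ e).K : ℂ) := by
  have key := triad_decomp hxe k
  have h1 := congrArg (fun w => w ⬝ᵥ k) key
  simp only [smul_dotProduct, add_dotProduct, smul_eq_mul] at h1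
  rw [dotProduct_comm e k, dotProduct_comm ξ k, dotProduct_comm (cross3 ξ e) k] at h1
  -- `h1 : e2 X2 K = (a X2) a + (s e2) s + c c`
  have he' : ((e ⬝ᵥ e : ℤ) : ℂ) ≠ 0 := by exact_mod_cast he
  have hX' : ((ξ ⬝ᵥ ξ : ℤ) : ℂ) ≠ 0 := by exact_mod_cast hX
  simp only [lineData_a, lineData_s, lineData_c, lineData_K, lineData_X2, lineData_e2, lineData_n2, hn]
  push_cast
  field_simp
  have h2 : ((e ⬝ᵥ e) * (ξ ⬝ᵥ ξ) * (k ⬝ᵥ k) : ℤ) =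
      (k ⬝ᵥ e) * (ξ ⬝ᵥ ξ) * (k ⬝ᵥ e) + (k ⬝ᵥ ξ) * (e ⬝ᵥ e) * (k ⬝ᵥ ξ) + (k ⬝ᵥ cross3 ξ e) * (k ⬝ᵥ cross3 ξ e) := h1
  have h3 := congrArg (fun z : ℤ => (z : ℂ)) h2
  push_cast at h3
  linear_combination (-1 : ℂ) * h3

end LineFacts

end Summit.AnomalousDissipation.AnomalousDissipation.Theorems.KolmogorovFloor.Response
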